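import Literature.AlgebraicGeometry.ModuliOfAbelianVarieties.SiegelShimuraSetIndexRepresentatives
import Literature.AlgebraicGeometry.ModuliOfAbelianVarieties.SiegelShimuraSetHeckeTranslate
import HarnessLib

/-!
# Right translates act on the piece index `Ξ_K = GSp_δ(ℚ)∖GSp_δ(𝔸_f)/K` through the multiplier only (`π₀`-equivariance)

Topic `AlgebraicGeometry/ModuliOfAbelianVarieties`; namespace `Literature.AlgebraicGeometry.ModuliOfAbelianVarieties.SiegelShimuraSet`.
THEOREMS ONLY (no definition, no named fact, no instance, no `sorry`); everything consumed BY NAME: ★ R60-13 `Index`/`indexOf`/`index`,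
★ R60-7 `SiegelShimuraSetHeckeTranslate` (right translates `T_γ`, `γ ∈ N(K)`), ★ R60-21A `SiegelShimuraSetIndexMultiplier`
(common multiplier ⇒ same index), ★ R60-21B′ (integral diagonal representatives), ★ R60-20 (sections of `ν`).

* §1 `indexOf_mul_eq_indexOf_mul_of_mem_normalizer` — for `γ ∈ N(K)` the right translate `a ↦ aγ` DESCENDS to `Ξ_K`
  (`indexOf a = indexOf b ⇒ indexOf (aγ) = indexOf (bγ)`); `index_rightTranslate` (the `Ξ_K`-coordinate of `T_γ c`).
* §2 **`indexOf_mul_eq_indexOf_mul_of_isMultiplier`** — the descended action depends on `γ` ONLY THROUGH `ν(γ)`: two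
  normalising elements with a common multiplier act identically on `Ξ_K` (`K` open, `0 < δ_i`; ★ R60-21A);
  **`indexOf_mul_eq_of_isMultiplier_of_mem`** — if `ν(γ)` is the multiplier of some `k ∈ K` then `T_γ` acts TRIVIALLY on `Ξ_K`;
  in particular the symplectic translates (`ν(γ) = 1`) preserve every piece (`indexOf_mul_eq_of_mem_symplecticGroupOfForm`).
* §3 the action on integral representatives: `indexOf (d(u) γ) = indexOf d(u·t)` for `γ ∈ K_δ(1)` with multiplier `t`
  (`indexOf_integral_diag_mul`) — «`GSp_δ(ẑ)` permutes `π₀(Sh_{K(N)})` through `ν : GSp_δ(ẑ) → ẑ^× → (ℤ/N)^×`», the set-level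
  shadow of the reciprocity law on connected components ([Deligne1971TravauxShimura] 2.7; [Milne2005ShimuraVarieties] §13, (62) on `π₀`)
  and of the Hecke action `HasIntegralHecke` (C4) on pieces.

D-CITE docstring edition (lit2 audit `lit/D-CITE-AUDIT-ClusterI-II.md` rows :61/:76, grade A): [Milne2005ShimuraVarieties]
Thm. 5.17 re-paged 61 → 59 (the `π₀` theorem's statement; proof pp. 60–61), «§5 (5.1)» re-anchored to §5 pp. 57–58 of the 2017
revision (double coset space p. 57, `T(g)` p. 58), [Deligne1971TravauxShimura] 2.7 re-paged 135 → 136; only docstring text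
changed — every declaration, statement and proof is byte-identical to ★ p658530.
Cell `hodgecm-mathlib`, #60 road (A-p05 TABLE v1.15, R60-41b / W2 «π₀-equivariance»); banked generic leaf, books 0.
HC_CM is proved only modulo the 7 printed citations until rung 0 closes.

## References
* [Milne2005ShimuraVarieties] J. S. Milne, *Introduction to Shimura varieties* (2005; 2017 revision), §5 pp. 57–58 (the double coset
  space `Sh_K(G,X)`, the right action `T(g)`), Lemma 5.12–5.13 p. 57, Thm. 5.17 p. 59, Rem. 5.29 (b) p. 65, Thm. 13.6 p. 118.
* [Deligne1971TravauxShimura] P. Deligne, *Travaux de Shimura* (1971), 1.8 p. 129, 2.7 p. 136, Déf. 3.1 p. 136, Exemple 4.16 p. 150.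
-/

set_option autoImplicit false

noncomputable section

open Matrix NumberField IsDedekindDomain

namespace Literature.AlgebraicGeometry.ModuliOfAbelianVarieties

namespace SiegelShimuraSet

variable {g : ℕ} (δ : Fin g → ℕ) (K : Subgroup (gspFinAdelic δ))

/-! ### §1. Right translates descend to the index -/

/-- **`a ↦ aγ` descends to `Ξ_K` for `γ ∈ N(K)`**: `indexOf a = indexOf b ⇒ indexOf (aγ) = indexOf (bγ)`
(`b = q a k` gives `bγ = q (aγ) (γ⁻¹kγ)` with `γ⁻¹kγ ∈ K`). [cite: Milne2005ShimuraVarieties, §5 p. 58, Lemma 5.13 p. 57] -/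
theorem indexOf_mul_eq_indexOf_mul_of_mem_normalizer {γ : gspFinAdelic δ}
    (hγ : γ ∈ Subgroup.normalizer (K : Set (gspFinAdelic δ))) {a b : gspFinAdelic δ}
    (h : indexOf δ K a = indexOf δ K b) : indexOf δ K (a * γ) = indexOf δ K (b * γ) := by
  rw [indexOf_eq_indexOf_iff] at h ⊢
  obtain ⟨q, k, hk, rfl⟩ := h
  refine ⟨q, γ⁻¹ * k * γ, ?_, by group⟩
  have h' := (Subgroup.mem_normalizer_iff''.mp hγ k).mp hk
  simpa only [mul_assoc] using h'

/-- **The `Ξ_K`-coordinate of a right translate**: if `T` acts by `[J, aK] ↦ [J, aγK]` (★ `existsUnique_rightTranslate`) then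
`index (T c) = indexOf (aγ)` for any representative `[J, aK] = c`. [cite: Milne2005ShimuraVarieties, Lemma 5.13 p. 57; Thm. 13.6 p. 118] -/
theorem index_rightTranslate {γ : gspFinAdelic δ} {T : SiegelShimuraSet δ K → SiegelShimuraSet δ K}
    (hT : ∀ (J : C0pm δ) (a : gspFinAdelic δ), T (SiegelShimuraSet.mk δ K J a) = SiegelShimuraSet.mk δ K J (a * γ))
    (J : C0pm δ) (a : gspFinAdelic δ) :
    index δ K (T (SiegelShimuraSet.mk δ K J a)) = indexOf δ K (a * γ) := by
  rw [hT, index_mk]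

/-- The descended action is compatible with `index`: `index c = index c′ ⇒ index (T c) = index (T c′)` for the right
translate `T = T_γ`, `γ ∈ N(K)`. [cite: Milne2005ShimuraVarieties, Lemma 5.13 p. 57] -/
theorem index_rightTranslate_eq_of_index_eq {γ : gspFinAdelic δ} (hγ : γ ∈ Subgroup.normalizer (K : Set (gspFinAdelic δ)))
    {T : SiegelShimuraSet δ K → SiegelShimuraSet δ K}
    (hT : ∀ (J : C0pm δ) (a : gspFinAdelic δ), T (SiegelShimuraSet.mk δ K J a) = SiegelShimuraSet.mk δ K J (a * γ))
    {c c' : SiegelShimuraSet δ K} (h : index δ K c = index δ K c') : index δ K (T c) = index δ K (T c') := by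
  obtain ⟨⟨J, a⟩, rfl⟩ := SiegelShimuraSet.mk_surjective δ K c
  obtain ⟨⟨J', a'⟩, rfl⟩ := SiegelShimuraSet.mk_surjective δ K c'
  change index δ K (T (SiegelShimuraSet.mk δ K J a)) = index δ K (T (SiegelShimuraSet.mk δ K J' a'))
  change index δ K (SiegelShimuraSet.mk δ K J a) = index δ K (SiegelShimuraSet.mk δ K J' a') at h
  rw [index_mk, index_mk] at h
  rw [index_rightTranslate δ K hT, index_rightTranslate δ K hT]
  exact indexOf_mul_eq_indexOf_mul_of_mem_normalizer δ K hγ h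

/-! ### §2. The descended action factors through the multiplier -/

/-- **`T_γ` on `Ξ_K` depends only on `ν(γ)`**: if `γ, γ′` have a common multiplier `t` then `indexOf (aγ) = indexOf (aγ′)` for
every `a ∈ GSp_δ(𝔸_{ℚ,f})` (`K` open, `0 < δ_i`; ★ R60-21A applied to `aγ`, `aγ′`, common multiplier `ν(a)·t`).
[cite: Milne2005ShimuraVarieties, Lemma 5.12 p. 57, Thm. 5.17 p. 59] -/
theorem indexOf_mul_eq_indexOf_mul_of_isMultiplier (hδ : ∀ i, 0 < δ i) (hK : IsOpen (K : Set (gspFinAdelic δ)))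
    {γ γ' : gspFinAdelic δ} {t : finAdeleQˣ}
    (hγ : IsMultiplier (typeFormOver δ finAdeleQ) (γ : GL (Fin g ⊕ Fin g) finAdeleQ) t)
    (hγ' : IsMultiplier (typeFormOver δ finAdeleQ) (γ' : GL (Fin g ⊕ Fin g) finAdeleQ) t) (a : gspFinAdelic δ) :
    indexOf δ K (a * γ) = indexOf δ K (a * γ') := by
  obtain ⟨ν, hν⟩ := a.2
  refine indexOf_eq_indexOf_of_isMultiplier δ K hδ hK (ν := ν * t) ?_ ?_
  · simpa only [Subgroup.coe_mul] using hν.mul hγ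
  · simpa only [Subgroup.coe_mul] using hν.mul hγ'

/-- **Translates whose multiplier is a multiplier of `K` act trivially on `Ξ_K`**: if `ν(γ) = ν(k)` for some `k ∈ K` then
`indexOf (aγ) = indexOf a` (`K` open, `0 < δ_i`). [cite: Milne2005ShimuraVarieties, Lemma 5.12 p. 57, Thm. 5.17 p. 59] -/
theorem indexOf_mul_eq_of_isMultiplier_of_mem (hδ : ∀ i, 0 < δ i) (hK : IsOpen (K : Set (gspFinAdelic δ)))
    {γ k : gspFinAdelic δ} {t : finAdeleQˣ} (hk : k ∈ K)
    (hγ : IsMultiplier (typeFormOver δ finAdeleQ) (γ : GL (Fin g ⊕ Fin g) finAdeleQ) t)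
    (hkt : IsMultiplier (typeFormOver δ finAdeleQ) (k : GL (Fin g ⊕ Fin g) finAdeleQ) t) (a : gspFinAdelic δ) :
    indexOf δ K (a * γ) = indexOf δ K a := by
  rw [indexOf_mul_eq_indexOf_mul_of_isMultiplier δ K hδ hK hγ hkt a, indexOf_eq_indexOf_iff]
  exact ⟨1, k⁻¹, K.inv_mem hk, by rw [map_one]; group⟩

/-- **Symplectic translates preserve every piece**: if `γ ∈ Sp(E_δ)(𝔸_{ℚ,f})` (multiplier `1`) then `indexOf (aγ) = indexOf a`
(`K` open, `0 < δ_i`) — `π₀(Sh_K)` is a `GSp/Sp = 𝔾_m`-set. [cite: Milne2005ShimuraVarieties, Lemma 5.12 p. 57, Thm. 5.17 p. 59] -/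
theorem indexOf_mul_eq_of_mem_symplecticGroupOfForm (hδ : ∀ i, 0 < δ i) (hK : IsOpen (K : Set (gspFinAdelic δ)))
    {γ : gspFinAdelic δ} (hγ : (γ : GL (Fin g ⊕ Fin g) finAdeleQ) ∈ symplecticGroupOfForm (typeFormOver δ finAdeleQ))
    (a : gspFinAdelic δ) : indexOf δ K (a * γ) = indexOf δ K a :=
  indexOf_mul_eq_of_isMultiplier_of_mem δ K hδ hK K.one_mem (mem_symplecticGroupOfForm_iff_isMultiplier_one.mp hγ)
    (by rw [OneMemClass.coe_one]; exact IsMultiplier.one _) a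

/-! ### §3. The action on integral diagonal representatives -/

/-- **`GSp_δ(ẑ)` permutes the pieces through `ν`**: for the integral diagonal representative `d(u) ∈ K_δ(1)` (★ R60-21B′,
★ R60-4) and `γ` with multiplier `t`, `indexOf (d(u)·γ) = indexOf x` for ANY `x` of multiplier `u·t` — e.g. `x = d(u·t)` when
`u·t ∈ ẑ^×` (`K` open, `0 < δ_i`). [cite: Milne2005ShimuraVarieties, Lemma 5.13 p. 57; Thm. 13.6 p. 118]
[cite: Deligne1971TravauxShimura, 2.7 p. 136] -/
theorem indexOf_mul_eq_indexOf_of_isMultiplier_mul (hδ : ∀ i, 0 < δ i) (hK : IsOpen (K : Set (gspFinAdelic δ)))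
    {d γ x : gspFinAdelic δ} {u t : finAdeleQˣ}
    (hd : IsMultiplier (typeFormOver δ finAdeleQ) (d : GL (Fin g ⊕ Fin g) finAdeleQ) u)
    (hγ : IsMultiplier (typeFormOver δ finAdeleQ) (γ : GL (Fin g ⊕ Fin g) finAdeleQ) t)
    (hx : IsMultiplier (typeFormOver δ finAdeleQ) (x : GL (Fin g ⊕ Fin g) finAdeleQ) (u * t)) :
    indexOf δ K (d * γ) = indexOf δ K x :=
  indexOf_eq_indexOf_of_isMultiplier δ K hδ hK (by simpa only [Subgroup.coe_mul] using hd.mul hγ) hx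

/-- **At principal level `K_δ(N)`, `γ ∈ K_δ(1)` with multiplier `t` sends the piece of `d(u)` to the piece of `d(u·t)`** (both
diagonal representatives in `K_δ(1)`, `u`, `t` `ẑ`-units — ★ R60-4's section at level `1`), `0 < δ_i`, `N ≠ 0`.
[cite: Milne2005ShimuraVarieties, Lemma 5.13 p. 57; Thm. 13.6 p. 118] [cite: Deligne1971TravauxShimura, 2.7 p. 136, 4.16 p. 150] -/
theorem indexOf_integral_diag_mul (hδ : ∀ i, 0 < δ i) {N : ℕ} (hN : N ≠ 0) {u t : finAdeleQˣ}
    (hu : ∀ v : HeightOneSpectrum (𝓞 ℚ), Valued.v ((u : finAdeleQ) v) = 1)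
    (ht : ∀ v : HeightOneSpectrum (𝓞 ℚ), Valued.v ((t : finAdeleQ) v) = 1)
    {d γ : gspFinAdelic δ}
    (hd : IsMultiplier (typeFormOver δ finAdeleQ) (d : GL (Fin g ⊕ Fin g) finAdeleQ) u)
    (hγ : IsMultiplier (typeFormOver δ finAdeleQ) (γ : GL (Fin g ⊕ Fin g) finAdeleQ) t) :
    ∃ x : gspFinAdelic δ, x ∈ principalLevelSubgroup δ 1 ∧
      IsMultiplier (typeFormOver δ finAdeleQ) (x : GL (Fin g ⊕ Fin g) finAdeleQ) (u * t) ∧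
      ((x : GL (Fin g ⊕ Fin g) finAdeleQ) : Matrix (Fin g ⊕ Fin g) (Fin g ⊕ Fin g) finAdeleQ) =
        Matrix.fromBlocks 1 0 0 (((u * t : finAdeleQˣ) : finAdeleQ) • (1 : Matrix (Fin g) (Fin g) finAdeleQ)) ∧
      indexOf δ (principalLevelSubgroup δ N) (d * γ) = indexOf δ (principalLevelSubgroup δ N) x := by
  have hut : ∀ v : HeightOneSpectrum (𝓞 ℚ), Valued.v (((u * t : finAdeleQˣ) : finAdeleQ) v) = 1 := fun v => by
    rw [Units.val_mul]
    exact Literature.NumberTheory.Adeles.forall_valued_mul_eq_one hu ht v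
  obtain ⟨h1, h2⟩ := sub_one_mem_levelIdeal_one_of_forall_valued_eq_one hut
  obtain ⟨x, hx1, hxm, hxd⟩ := exists_mem_principalLevelSubgroup_isMultiplier δ (N := 1) (u * t) h1 h2
  exact ⟨x, hx1, hxm, hxd, indexOf_mul_eq_indexOf_of_isMultiplier_mul δ _ hδ (isOpen_principalLevelSubgroup δ hN) hd hγ hxm⟩

end SiegelShimuraSet

end Literature.AlgebraicGeometry.ModuliOfAbelianVarieties

end
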